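import Mathlib
import Summits.NavierStokesRegularity.NavierStokesRegularity.Theses.TaoLadderRungThree
import Literature.Analysis.FluidPDE.Tao2016AveragedNS.RestartedCascadeFlows
import Summits.NavierStokesRegularity.NavierStokesRegularity.Theses.HeteroclinicTriggerChain

/-! LEAD SKELETON (prover-ns-htc-p1, reshaped from the planner's BC3 birth skeleton) for crux `TriggerChainFrontStep` of route HeteroclinicTriggerChain (imports the landed route file; concludes the route decl BY NAME). Line: the unfolded chain yields v2 GAP DATA
analytically (stub_chain_gap), and the host's universal robustness theorem K_B v2 (stub_gapped_front_robust_v2 = TaoLadderRungThree.GappedFrontRobustV2,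
open item) turns it into the pinned robust front step. Plus the BC5 rung `rung_complete_transfer` (PROVED, no sorry; also proposed as Theorems/HeteroclinicTriggerChainTransferArc.lean p573423) (the efficiency-1 hop of the
three-mode arc, phase-line analysis). -/

open Filter Topology

namespace Summit.NavierStokesRegularity.NavierStokesRegularity.Theses.HeteroclinicTriggerChain.Birth
set_option linter.dupNamespace false
set_option linter.deprecated false

/-- stub (S, PROVABLE NOW — lead reshaping 2026-08-27): the NORMAL FORM of a symmetric cancelling table at a
diagonal pure-mode saddle — the purely algebraic consequences of (purity) + (saddle) + (4.2) + (4.3): `α i₀ i₀ · ≡ 0`,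
no up-transfer or back-reaction entry with a carrier input off the diagonal, the rate table `d` (with `d i₀ ≡ 0`: the
pure-mode family is a centre direction), and the diagonal pump structure of everything that feeds the carrier. -/
theorem stub_normal_form : ∀ (α : Fin 4 → Fin 4 → Fin 4 → ℤ × ℤ × ℤ → ℝ) (i₀ : Fin 4) (d : Fin 4 → ℤ → ℝ),
    Literature.Analysis.FluidPDE.TaoCascade.IsSymmetricCoeff α →
    Literature.Analysis.FluidPDE.TaoCascade.IsCancellingCoeff α →
    (∀ X : Fin 4 → ℤ → ℝ → ℝ, (∀ i n t, i ≠ i₀ → X i n t = 0) →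
      ∀ i n t, Literature.Analysis.FluidPDE.TaoCascade.quadTerm 1 α X i n t = 0) →
    (∀ (Y : Fin 4 → ℤ → ℝ → ℝ) (i : Fin 4) (n : ℤ) (t : ℝ),
      Literature.Analysis.FluidPDE.TaoCascade.quadTerm 1 α
          (fun j m s => (fun j m (_ : ℝ) => if j = i₀ ∧ m = 0 then (1 : ℝ) else 0) j m s + Y j m s) i n t -
        Literature.Analysis.FluidPDE.TaoCascade.quadTerm 1 α
          (fun j m (_ : ℝ) => if j = i₀ ∧ m = 0 then (1 : ℝ) else 0) i n t -
        Literature.Analysis.FluidPDE.TaoCascade.quadTerm 1 α Y i n t = d i n * Y i n t) →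
    (∀ (i : Fin 4) (μ : ℤ × ℤ × ℤ), μ ∈ Literature.Analysis.FluidPDE.TaoCascade.shiftSet →
      α i₀ i₀ i μ = 0) ∧
    (∀ j i : Fin 4, α i₀ j i (0, 0, 1) = 0 ∧ α j i₀ i (0, 0, 1) = 0 ∧
      α j i₀ i (1, 0, 0) = 0 ∧ α i₀ j i (0, 1, 0) = 0) ∧
    (∀ j i : Fin 4, j ≠ i → α i₀ j i (0, 0, 0) = 0 ∧ α j i₀ i (0, 0, 0) = 0 ∧
      α i₀ j i (1, 0, 0) = 0 ∧ α j i₀ i (0, 1, 0) = 0) ∧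
    (∀ i : Fin 4, d i 0 = 2 * α i₀ i i (0, 0, 0)) ∧
    (∀ i : Fin 4, d i (-1) = (2 : ℝ) ^ (-((3 : ℝ) / 2)) * α i₀ i i (1, 0, 0)) ∧
    (∀ (i : Fin 4) (n : ℤ), n ≠ 0 → n ≠ -1 → d i n = 0) ∧
    (∀ n : ℤ, d i₀ n = 0) ∧
    (∀ j₁ j₂ : Fin 4, j₁ ≠ j₂ → α j₁ j₂ i₀ (0, 0, 1) = 0 ∧ α j₁ j₂ i₀ (0, 0, 0) = 0) ∧
    (∀ j : Fin 4, α j j i₀ (0, 0, 0) = -(2 * α i₀ j j (0, 0, 0)) ∧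
      α i₀ j j (1, 0, 0) = -(α j j i₀ (0, 0, 1)) / 2 ∧ α j i₀ j (0, 1, 0) = -(α j j i₀ (0, 0, 1)) / 2 ∧
      d j (-1) = -((2 : ℝ) ^ (-((5 : ℝ) / 2))) * α j j i₀ (0, 0, 1)) := by
  sorry

/-- stub (L, the hard analytic core): GIVEN the normal form of the table (stub_normal_form, available as a
hypothesis), the unfolded trigger chain admits v2 gap data ANALYTICALLY — reference set = the seeded collar around
the chain, weights from the super-geometric silence of unseeded shells, contraction from the saddle passage with
seed ≍ β; includes local existence of exact lattice flows on the clock window from the ball (exist₀). -/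
theorem stub_chain_gap_of_normal_form : (∀ (α : Fin 4 → Fin 4 → Fin 4 → ℤ × ℤ × ℤ → ℝ) (i₀ : Fin 4) (d : Fin 4 → ℤ → ℝ),
    Literature.Analysis.FluidPDE.TaoCascade.IsSymmetricCoeff α →
    Literature.Analysis.FluidPDE.TaoCascade.IsCancellingCoeff α →
    (∀ X : Fin 4 → ℤ → ℝ → ℝ, (∀ i n t, i ≠ i₀ → X i n t = 0) →
      ∀ i n t, Literature.Analysis.FluidPDE.TaoCascade.quadTerm 1 α X i n t = 0) →
    (∀ (Y : Fin 4 → ℤ → ℝ → ℝ) (i : Fin 4) (n : ℤ) (t : ℝ),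
      Literature.Analysis.FluidPDE.TaoCascade.quadTerm 1 α
          (fun j m s => (fun j m (_ : ℝ) => if j = i₀ ∧ m = 0 then (1 : ℝ) else 0) j m s + Y j m s) i n t -
        Literature.Analysis.FluidPDE.TaoCascade.quadTerm 1 α
          (fun j m (_ : ℝ) => if j = i₀ ∧ m = 0 then (1 : ℝ) else 0) i n t -
        Literature.Analysis.FluidPDE.TaoCascade.quadTerm 1 α Y i n t = d i n * Y i n t) →
    (∀ (i : Fin 4) (μ : ℤ × ℤ × ℤ), μ ∈ Literature.Analysis.FluidPDE.TaoCascade.shiftSet →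
      α i₀ i₀ i μ = 0) ∧
    (∀ j i : Fin 4, α i₀ j i (0, 0, 1) = 0 ∧ α j i₀ i (0, 0, 1) = 0 ∧
      α j i₀ i (1, 0, 0) = 0 ∧ α i₀ j i (0, 1, 0) = 0) ∧
    (∀ j i : Fin 4, j ≠ i → α i₀ j i (0, 0, 0) = 0 ∧ α j i₀ i (0, 0, 0) = 0 ∧
      α i₀ j i (1, 0, 0) = 0 ∧ α j i₀ i (0, 1, 0) = 0) ∧
    (∀ i : Fin 4, d i 0 = 2 * α i₀ i i (0, 0, 0)) ∧
    (∀ i : Fin 4, d i (-1) = (2 : ℝ) ^ (-((3 : ℝ) / 2)) * α i₀ i i (1, 0, 0)) ∧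
    (∀ (i : Fin 4) (n : ℤ), n ≠ 0 → n ≠ -1 → d i n = 0) ∧
    (∀ n : ℤ, d i₀ n = 0) ∧
    (∀ j₁ j₂ : Fin 4, j₁ ≠ j₂ → α j₁ j₂ i₀ (0, 0, 1) = 0 ∧ α j₁ j₂ i₀ (0, 0, 0) = 0) ∧
    (∀ j : Fin 4, α j j i₀ (0, 0, 0) = -(2 * α i₀ j j (0, 0, 0)) ∧
      α i₀ j j (1, 0, 0) = -(α j j i₀ (0, 0, 1)) / 2 ∧ α j i₀ j (0, 1, 0) = -(α j j i₀ (0, 0, 1)) / 2 ∧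
      d j (-1) = -((2 : ℝ) ^ (-((5 : ℝ) / 2))) * α j j i₀ (0, 0, 1))) → ∀ R : ℝ, 1 ≤ R → ∀ α₀ σ : Fin 4 → Fin 4 → Fin 4 → ℤ × ℤ × ℤ → ℝ, (Literature.Analysis.FluidPDE.TaoCascade.InTableClass R α₀ ∧ (∀ β : ℝ, 0 < β → β ≤ 1 → Literature.Analysis.FluidPDE.TaoCascade.InTableClass (R / β) (fun j₁ j₂ j₃ μ => α₀ j₁ j₂ j₃ μ + β * σ j₁ j₂ j₃ μ)) ∧ ∃ (i₀ i₁ : Fin 4) (e κ K : ℝ) (d : Fin 4 → ℤ → ℝ) (H : Fin 4 → ℤ → ℝ → ℝ), i₀ ≠ i₁ ∧ 0 < e ∧ 0 < κ ∧ 0 < K ∧ (∀ X : Fin 4 → ℤ → ℝ → ℝ, (∀ i n t, i ≠ i₀ → X i n t = 0) → ∀ i n t, Literature.Analysis.FluidPDE.TaoCascade.quadTerm 1 α₀ X i n t = 0 ∧ Literature.Analysis.FluidPDE.TaoCascade.quadTerm 1 σ X i n t = 0) ∧ (∀ (j₁ j₂ j₃ : Fin 4) (μ : ℤ × ℤ ×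 ℤ), Xor' (Xor' (j₁ = i₁) (j₂ = i₁)) (j₃ = i₁) → α₀ j₁ j₂ j₃ μ = 0 ∧ σ j₁ j₂ j₃ μ = 0) ∧ (∀ (Y : Fin 4 → ℤ → ℝ → ℝ) (i : Fin 4) (n : ℤ) (t : ℝ), Literature.Analysis.FluidPDE.TaoCascade.quadTerm 1 α₀ (fun j m s => (fun j m (_ : ℝ) => if j = i₀ ∧ m = 0 then (1 : ℝ) else 0) j m s + Y j m s) i n t - Literature.Analysis.FluidPDE.TaoCascade.quadTerm 1 α₀ (fun j m (_ : ℝ) => if j = i₀ ∧ m = 0 then (1 : ℝ) else 0) i n t - Literature.Analysis.FluidPDE.TaoCascade.quadTerm 1 α₀ Y i n t = d i n * Y i n t) ∧ d i₁ 0 = e ∧ (∀ i n, ¬ (i = i₁ ∧ n = 0) → d i n ≤ 0) ∧ (∀ i n t, HasDerivAt (H i n) (Literature.Analysis.FluidPDE.TaoCascade.quadTerm 1 α₀ H i n t) t) ∧ (∀ i n t, n < 0 → H i n t = 0) ∧ (∀ i n t, 1 ≤ n → i ≠ i₀ → H i n t = 0) ∧ (∀ i n t, 2 ≤ n → H i n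 t = 0) ∧ (∀ i n, Filter.Tendsto (H i n) Filter.atBot (nhds (if i = i₀ ∧ n = 0 then (1 : ℝ) else 0))) ∧ (∀ i n, Filter.Tendsto (H i n) Filter.atTop (nhds (if i = i₀ ∧ n = 1 then (1 : ℝ) else 0))) ∧ (∀ i n t, t ≤ 0 → |H i n t - (if i = i₀ ∧ n = 0 then (1 : ℝ) else 0)| ≤ K * Real.exp (e * t)) ∧ (∀ t : ℝ, t ≤ 0 → K⁻¹ * Real.exp (e * t) ≤ |H i₁ 0 t|) ∧ (∀ i n t, 0 ≤ t → |H i n t - (if i = i₀ ∧ n = 1 then (1 : ℝ) else 0)| ≤ K * Real.exp (-(κ * t))) ∧ (∃ t : ℝ, Literature.Analysis.FluidPDE.TaoCascade.quadTerm 1 σ H i₁ 1 t ≠ 0)) → ∃ β : ℝ, 0 < β ∧ β ≤ 1 ∧ ∃ (σ' : ℝ) (j₀ : Fin 4) (X₀ : Fin 4 → ℝ) (Z : Set (Fin 4 → ℤ → ℝ)) (w : ℤ → ℝ) (r ρ θ₀ θ c₀ c : ℝ) (env₀ : ℤ → ℝ), 0 ≤ θ ∧ X₀ j₀ ≠ 0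 ∧ Literature.Analysis.FluidPDE.TaoCascade.GapData₂ σ' 1 j₀ (fun j₁ j₂ j₃ μ => α₀ j₁ j₂ j₃ μ + β * σ j₁ j₂ j₃ μ) X₀ Z w r ρ θ₀ θ c₀ c env₀ ∧ (∀ ϑ : ℝ, 0 < ϑ → ∃ k₂ : ℤ, ∀ k : ℤ, k₂ ≤ k → (1 + (1 : ℝ)) ^ ((5 : ℝ) * (k + 2) / 2) * r * w (k + 1) ≤ ϑ * w k ^ 2) := by
  sorry

/-- stub (L, = host open item TaoLadderRungThree.GappedFrontRobustV2, shared): v2 gap data ⇒ margin η and envelope with FrontExists and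
RobustStep for the r-ball. -/
theorem stub_gapped_front_robust_v2 : ∀ (R σ ε₀ : ℝ) (i₀ : Fin 4) (α : Fin 4 → Fin 4 → Fin 4 → ℤ × ℤ × ℤ → ℝ) (X₀ : Fin 4 → ℝ) (Z : Set (Fin 4 → ℤ → ℝ)) (w : ℤ → ℝ) (r ρ θ₀ θ c₀ c : ℝ) (env₀ : ℤ → ℝ), Literature.Analysis.FluidPDE.TaoCascade.InTableClass R α → 0 < ε₀ → Literature.Analysis.FluidPDE.TaoCascade.GapData₂ σ ε₀ i₀ α X₀ Z w r ρ θ₀ θ c₀ c env₀ → (∀ ϑ : ℝ, 0 < ϑ → ∃ k₂ : ℤ, ∀ k : ℤ, k₂ ≤ k → (1 + ε₀) ^ ((5 : ℝ) * (k + 2) / 2) * r * w (k + 1) ≤ ϑ * w k ^ 2) → ∃ (η : ℝ) (env : ℤ → ℝ), 0 < η ∧ Literature.Analysis.FluidPDE.TaoCascade.FrontExists ε₀ θ c η α (Literature.Analysis.FluidPDE.TaoCascade.ballDesc Z w r) env ∧ Literature.Analysis.FluidPDE.TaoCascade.RobustStep ε₀ θ c η i₀ α (Literature.Analysis.FluidPDE.TaoCascade.ballDesc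 Z w r) env := by
  sorry

/-- BC5 rung (PROVED; logistic reduction): COMPLETE TRANSFER of the three-mode arc — on the invariant circle x + y = 1,
x² + u² + y² = 1 with u(0) > 0, the solution of x′ = −eu², u′ = exu − euy, y′ = eu² tends to the pure receiver (0,0,1): transfer
efficiency 1 > 1/2 at λ = 2 (outside S's known regime: no comparable table is known to blow up at ε₀ = 1). -/
theorem rung_complete_transfer : ∀ e : ℝ, 0 < e → ∀ x u y : ℝ → ℝ,
    (∀ t, HasDerivAt x (-(e * u t ^ 2)) t) → (∀ t, HasDerivAt u (e * x t * u t - e * u t * y t) t) →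
    (∀ t, HasDerivAt y (e * u t ^ 2) t) → x 0 + y 0 = 1 → x 0 ^ 2 + u 0 ^ 2 + y 0 ^ 2 = 1 → 0 < u 0 →
    Filter.Tendsto y Filter.atTop (nhds 1) ∧ Filter.Tendsto x Filter.atTop (nhds 0) ∧ Filter.Tendsto u Filter.atTop (nhds 0) := by
  intro e he x u y hx hu hy hL hE hu0
  -- conservation of x + y
  have hLt : ∀ t, x t + y t = 1 := by
    have hd : Differentiable ℝ (x + y) := fun t => ((hx t).add (hy t)).differentiableAt
    have hd' : ∀ t, deriv (x + y) t = 0 := fun t => by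
      rw [((hx t).add (hy t)).deriv]; ring
    intro t
    have h := is_const_of_deriv_eq_zero hd hd' t 0
    simp only [Pi.add_apply] at h
    linarith
  -- conservation of the energy
  have hEt : ∀ t, x t ^ 2 + u t ^ 2 + y t ^ 2 = 1 := by
    have hder : ∀ t, HasDerivAt (x ^ 2 + (u ^ 2 + y ^ 2))
        (↑(2 : ℕ) * x t ^ (2 - 1) * (-(e * u t ^ 2)) + (↑(2 : ℕ) * u t ^ (2 - 1) * (e * x t * u t - e * u t * y t) +
          ↑(2 : ℕ) * y t ^ (2 - 1) * (e * u t ^ 2))) t := fun t =>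
      ((hx t).pow 2).add (((hu t).pow 2).add ((hy t).pow 2))
    have hd : Differentiable ℝ (x ^ 2 + (u ^ 2 + y ^ 2)) := fun t => (hder t).differentiableAt
    have hd' : ∀ t, deriv (x ^ 2 + (u ^ 2 + y ^ 2)) t = 0 := fun t => by
      rw [(hder t).deriv]
      norm_num
      ring
    intro t
    have h := is_const_of_deriv_eq_zero hd hd' t 0
    simp only [Pi.add_apply, Pi.pow_apply] at h
    linarith
  -- logistic reduction
  have hx_eq : ∀ t, x t = 1 - y t := fun t => by linarith [hLt t]
  have hu2 : ∀ t, u t ^ 2 = 2 * y t * (1 - y t) := fun t => by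
    have h := hEt t
    rw [hx_eq t] at h
    nlinarith [h]
  have hprod : ∀ t, 0 ≤ y t * (1 - y t) := fun t => by nlinarith [hu2 t, sq_nonneg (u t)]
  have hy_le : ∀ t, y t ≤ 1 := fun t => by nlinarith [hprod t]
  have hy_ge : ∀ t, 0 ≤ y t := fun t => by nlinarith [hprod t]
  have hy0 : 0 < y 0 := by
    have h : 0 < y 0 * (1 - y 0) := by nlinarith [hu2 0, hu0]
    nlinarith [h, hy_le 0]
  -- monotonicity of y
  have hdiff : Differentiable ℝ y := fun t => (hy t).differentiableAt
  have hderiv : ∀ t, deriv y t = 2 * e * (y t * (1 - y t)) := fun t => by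
    rw [(hy t).deriv, hu2 t]; ring
  have hmono : Monotone y := monotone_of_deriv_nonneg hdiff (fun t => by
    rw [hderiv t]; exact mul_nonneg (by linarith) (hprod t))
  -- y exceeds every level below 1
  have hreach : ∀ ε : ℝ, 0 < ε → ∃ T : ℝ, 1 - ε < y T := by
    intro ε hε
    by_contra hcon
    push_neg at hcon
    set m : ℝ := 2 * e * (y 0 * ε) with hm
    have hmpos : 0 < m := mul_pos (mul_pos two_pos he) (mul_pos hy0 hε)
    have hbound : ∀ s ∈ interior (Set.Ici (0 : ℝ)), m ≤ deriv y s := by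
      intro s hs
      rw [interior_Ici] at hs
      rw [hderiv s]
      have h1 : y 0 ≤ y s := hmono (le_of_lt hs)
      have h2 : ε ≤ 1 - y s := by linarith [hcon s]
      have h3 : y 0 * ε ≤ y s * (1 - y s) := mul_le_mul h1 h2 hε.le (hy_ge s)
      nlinarith [h3]
    have hmvt := (convex_Ici (0 : ℝ)).mul_sub_le_image_sub_of_le_deriv hdiff.continuous.continuousOn
      (hdiff.differentiableOn) hbound 0 (by simp) (1 / m) (by simpa using (div_pos one_pos hmpos).le) (div_pos one_pos hmpos).le
    have h1m : m * (1 / m - 0) = 1 := by rw [sub_zero]; exact mul_one_div_cancel hmpos.ne'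
    rw [h1m] at hmvt
    have := hcon (1 / m)
    linarith [hy_le (1 / m), hε]
  -- the limits
  have hY : Tendsto y atTop (𝓝 1) := by
    rw [tendsto_order]
    refine ⟨fun a ha => ?_, fun b hb => Eventually.of_forall fun t => lt_of_le_of_lt (hy_le t) hb⟩
    obtain ⟨T, hT⟩ := hreach (1 - a) (by linarith)
    exact eventually_atTop.2 ⟨T, fun t ht => by linarith [hmono ht]⟩
  have hX : Tendsto x atTop (𝓝 0) := by
    have hfun : x = fun t => 1 - y t := funext hx_eq
    rw [hfun]
    simpa using (tendsto_const_nhds : Tendsto (fun _ : ℝ => (1 : ℝ)) atTop (𝓝 1)).sub hY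
  have hU2 : Tendsto (fun t => u t ^ 2) atTop (𝓝 0) := by
    have hfun : (fun t => u t ^ 2) = fun t => 2 * y t * (1 - y t) := funext hu2
    rw [hfun]
    simpa using ((tendsto_const_nhds : Tendsto (fun _ : ℝ => (2 : ℝ)) atTop (𝓝 2)).mul hY).mul ((tendsto_const_nhds : Tendsto (fun _ : ℝ => (1 : ℝ)) atTop (𝓝 1)).sub hY)
  have hU : Tendsto u atTop (𝓝 0) := by
    rw [tendsto_zero_iff_norm_tendsto_zero]
    have h := (Real.continuous_sqrt.tendsto 0).comp hU2
    rw [Real.sqrt_zero] at h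
    refine h.congr fun t => ?_
    simp [Real.sqrt_sq_eq_abs, Real.norm_eq_abs]
  exact ⟨hY, hX, hU⟩


theorem TriggerChainFrontStep_of : TriggerChainFrontStep := by
  have h1 := stub_chain_gap_of_normal_form stub_normal_form
  have h2 := stub_gapped_front_robust_v2
  intro R hR α₀ σ hchain
  obtain ⟨β, hβ, hβ1, σ', j₀, X₀, Z, w, r, ρ, θ₀, θ, c₀, c, env₀, hθ0, hX₀, hgap, hgrowth⟩ := h1 R hR α₀ σ hchain
  have hT : Literature.Analysis.FluidPDE.TaoCascade.InTableClass (R / β) (fun j₁ j₂ j₃ μ => α₀ j₁ j₂ j₃ μ + β * σ j₁ j₂ j₃ μ) := hchain.2.1 β hβ hβ1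
  obtain ⟨η, env, hη, hfe, hrs⟩ := h2 (R / β) σ' 1 j₀ (fun j₁ j₂ j₃ μ => α₀ j₁ j₂ j₃ μ + β * σ j₁ j₂ j₃ μ) X₀ Z w r ρ θ₀ θ c₀ c env₀ hT one_pos hgap hgrowth
  have hs := hgap.toGapData.signs
  refine ⟨β, hβ, hβ1, θ, c, η, j₀, X₀, Literature.Analysis.FluidPDE.TaoCascade.ballDesc Z w r, env, hθ0, hs.2.2.2.2.2.1, by linarith [hs.2.2.2.2.2.2.1, hs.2.2.2.2.2.2.2.1], hη, hT, hX₀,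
    hgap.toGapData.datum_mem_ball _, hfe, hrs⟩

end Summit.NavierStokesRegularity.NavierStokesRegularity.Theses.HeteroclinicTriggerChain.Birth
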